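import Mathlib
import HarnessLib
import Literature.MathematicalPhysics.QuantumFieldTheory.GaussianQuadraticChaosMGF
import Literature.MathematicalPhysics.QuantumFieldTheory.GaussianCovarianceComparison

/-!
# `|E_{N(0,S₁)} H − E_{N(0,S₀)} H| ≤ 8q·h·‖H‖_{L^p(N(0,S₀))}` with `h` the HILBERT–SCHMIDT size of the
# covariance change — the DIMENSION-FREE comparison of [Buc16] Thm 4.5 / [ABKM19] Thm 6.2 (`ℓ = 1`)

The tree's `GaussianCovarianceComparisonEstimate.abs_integral_multivariateGaussian_sub_le` compares the
expectations of an `L^p` functional under two close centred Gaussians with the constant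
`gaussCompConst |ι| q ~ e^{3|ι|/16}`, exponential in the number of modes: it prices the log-density
`Z = log(dN(0,S₁)/dN(0,S₀))` by `δ·(|ι| + ½yᵀS₀⁻¹y)`, i.e. by the SUPREMUM of the per-mode relative changes
times the dimension.  [Buc16] Thm 4.5 instead prices `Z` by the Hilbert–Schmidt norm of the relative change
(`‖M^{-1/2}ṀM^{-1/2}‖_HS`, Lemma 4.6 = Whittle's inequality), a SUM OF SQUARES over the modes — this is
the half of the volume-independence of [ABKM19] Lemma 8.4 (the other half is the localisation of an
`X`-local functional to a torus of side `≈ 2 diam X` by the finite range of the decomposition).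
This file proves the Hilbert–Schmidt-priced comparison in finite dimensions, in the integrated
(difference) form the renormalisation-group files consume:

* `trace_sqrt_sandwich_mul_self` — `tr((√S B √S)²) = tr((SB)²)`;
* `integral_rpow_abs_mul_exp_abs_le` — abstract: two-sided exponential moments `∫(e^{tZ} + e^{−tZ}) ≤ 2e`
  for `t h ≤ ½` give `∫ (|Z|e^{|Z|})^q ≤ (4hq/e)^q · 2e` (`qh ≤ ¼`);
* `integral_exp_mul_logDensity_le`, `integral_exp_add_exp_logDensity_le` — the exponential moments of
  `Z = c + ½(yᵀBy − tr √S₀B√S₀)` from `GaussianQuadraticChaosMGF.integral_exp_mul_quadForm_sub_trace_le`;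
* `half_sum_log_one_sub_add_mem` — the normalising constant `c = ½Σ(log(1−λᵢ)+λᵢ) ∈ [−h², 0]`;
* **`abs_integral_multivariateGaussian_sub_le_of_trace`** — for `S₀, S₁ ≻ 0` with
  `tr((1 − S₀S₁⁻¹)²) ≤ h²`, `0 ≤ h ≤ 1/(4q)`, `p, q` Hölder conjugate, `H ∈ L^p(N(0,S₀))`:
  `|∫ H dN(0,S₁) − ∫ H dN(0,S₀)| ≤ 8 q h (∫ |H|^p dN(0,S₀))^{1/p}` — no dependence on `|ι|`.

The smallness `h ≤ 1/(4q)` is removed downstream by telescoping along the segment of covariances (each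
piece costs `8q·h/m`), which is why the integrated form suffices.  Everything is proved; no named fact;
finite-dimensional Gaussian calculus only (nothing here is about the torus, the renormalisation group or
any summit).

## References
* S. Buchholz, *Finite range decomposition for Gaussian measures with improved regularity*,
  J. Funct. Anal. 275 (2018), Thm 4.5, Lemma 4.6 [Buchholz2016].
* S. Adams, S. Buchholz, R. Kotecký, S. Müller, arXiv:1910.13564, Theorem 6.2, Lemma 8.4
  [AdamsBuchholzKoteckyMuller2019].
-/

noncomputable section

namespace Literature.MathematicalPhysics.QuantumFieldTheory

open MeasureTheory ProbabilityTheory Matrix WithLp GaussianToolkit Unitary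
open scoped ENNReal NNReal MatrixOrder BigOperators

variable {ι : Type*} [Fintype ι] [DecidableEq ι]

/-! ## The trace form of the Hilbert–Schmidt datum -/

/-- `tr((√S B √S)²) = tr((S B)²)` for `S ≻ 0` (cyclicity of the trace).
[cite: Buchholz2016, Thm 4.5 (proof: "‖M^{-1/2} Ṁ M^{-1/2}‖_HS")] -/
theorem trace_sqrt_sandwich_mul_self {S : Matrix ι ι ℝ} (hS : S.PosDef) (B : Matrix ι ι ℝ) :
    ((CFC.sqrt S * B * CFC.sqrt S) * (CFC.sqrt S * B * CFC.sqrt S)).trace = ((S * B) * (S * B)).trace := by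
  set R : Matrix ι ι ℝ := CFC.sqrt S with hR
  have hRR : R * R = S := sqrt_mul_sqrt hS
  have h1 : R * B * R * (R * B * R) = R * (B * S * B) * R := by
    rw [← hRR]; simp only [Matrix.mul_assoc]
  rw [h1, Matrix.trace_mul_cycle, hRR]
  congr 1
  simp only [Matrix.mul_assoc]

/-! ## An abstract moment lemma: `∫ (|Z| e^{|Z|})^q` from two-sided exponential moments of `Z` -/

omit [Fintype ι] [DecidableEq ι] in
/-- AM–GM in the form used to split `|Z|^q e^{q|Z|}`: `X·Y·(2a) ≤ X² + a²Y²`.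
[cite: Buchholz2016, Thm 4.5 (proof)] -/
theorem mul_mul_two_mul_le_sq_add_sq (X Y a : ℝ) : X * Y * (2 * a) ≤ X ^ 2 + a ^ 2 * Y ^ 2 := by
  nlinarith [sq_nonneg (X - a * Y)]

omit [Fintype ι] [DecidableEq ι] in
/-- **From exponential moments to the `q`-th moment of `|Z|e^{|Z|}`.**  If a real random variable `Z`
satisfies `∫ (e^{tZ} + e^{−tZ}) dμ ≤ 2e` for all `0 ≤ t` with `t·h ≤ ½` (`0 < h`, `1 < q`, `qh ≤ ¼`), then
`(|Z| e^{|Z|})^q` is integrable and `∫ (|Z| e^{|Z|})^q dμ ≤ (4hq/e)^q · 2e`.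
(Moments of `Z` at `t = 1/(2h)`, the exponential factor at `t = 2q`, split by AM–GM.)
[cite: Buchholz2016, Thm 4.5 (proof)] -/
theorem integral_rpow_abs_mul_exp_abs_le {α : Type*} [MeasurableSpace α] {μ : Measure α} {Z : α → ℝ}
    (hZm : AEStronglyMeasurable Z μ) {h q : ℝ} (hh : 0 < h) (hq : 1 < q) (hqh : q * h ≤ 1 / 4)
    (hmgf : ∀ t : ℝ, 0 ≤ t → t * h ≤ 1 / 2 →
      Integrable (fun y => Real.exp (t * Z y) + Real.exp (-(t * Z y))) μ ∧
      ∫ y, (Real.exp (t * Z y) + Real.exp (-(t * Z y))) ∂μ ≤ 2 * Real.exp 1) :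
    Integrable (fun y => (|Z y| * Real.exp |Z y|) ^ q) μ ∧
      ∫ y, (|Z y| * Real.exp |Z y|) ^ q ∂μ ≤ (4 * h * q / Real.exp 1) ^ q * (2 * Real.exp 1) := by
  have hq0 : 0 < q := by linarith
  -- `t = 1/(2h)` for the moment bound, `a = (4hq/e)^q` for the AM–GM split
  set t : ℝ := 1 / (2 * h) with htdef
  have ht : 0 < t := by positivity
  have hth : t * h ≤ 1 / 2 := by rw [htdef]; field_simp; norm_num
  set a : ℝ := (4 * h * q / Real.exp 1) ^ q with hadef
  have hbase : 0 < 4 * h * q / Real.exp 1 := by positivity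
  have ha : 0 < a := Real.rpow_pos_of_pos hbase q
  have ha2 : a ^ 2 = (4 * h * q / Real.exp 1) ^ (2 * q) := by
    rw [hadef, ← Real.rpow_natCast, ← Real.rpow_mul hbase.le]
    congr 1; push_cast; ring
  -- pointwise: `g^q ≤ (|Z|^{2q} + a² e^{2q|Z|}) / (2a)`
  have hgq : ∀ y, (|Z y| * Real.exp |Z y|) ^ q ≤
      (|Z y| ^ (2 * q) + a ^ 2 * Real.exp (2 * q * |Z y|)) / (2 * a) := by
    intro y
    have hgq_eq : (|Z y| * Real.exp |Z y|) ^ q = |Z y| ^ q * Real.exp (q * |Z y|) := by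
      rw [Real.mul_rpow (abs_nonneg _) (Real.exp_pos _).le, ← Real.exp_mul, mul_comm (|Z y|) q]
    have hX2 : (|Z y| ^ q) ^ 2 = |Z y| ^ (2 * q) := by
      rw [← Real.rpow_natCast, ← Real.rpow_mul (abs_nonneg _)]
      congr 1; push_cast; ring
    have hY2 : (Real.exp (q * |Z y|)) ^ 2 = Real.exp (2 * q * |Z y|) := by
      rw [pow_two, ← Real.exp_add]; congr 1; ring
    rw [hgq_eq, le_div_iff₀ (by positivity), ← hX2, ← hY2]
    exact mul_mul_two_mul_le_sq_add_sq _ _ _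
  -- the `2q`-th moment of `Z`
  have hZpow_le : ∀ y, |Z y| ^ (2 * q) ≤
      (2 * q / (Real.exp 1 * t)) ^ (2 * q) * (Real.exp (t * Z y) + Real.exp (-(t * Z y))) :=
    fun y => abs_rpow_le_mul_exp_add_exp ht (by positivity) (Z y)
  have hZabs_m : AEStronglyMeasurable (fun y => |Z y|) μ := continuous_abs.comp_aestronglyMeasurable hZm
  have hZpow_int : Integrable (fun y => |Z y| ^ (2 * q)) μ := by
    refine Integrable.mono' (((hmgf t ht.le hth).1).const_mul ((2 * q / (Real.exp 1 * t)) ^ (2 * q))) ?_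
      (Filter.Eventually.of_forall fun y => ?_)
    · exact (Real.continuous_rpow_const (by positivity)).comp_aestronglyMeasurable hZabs_m
    · rw [Real.norm_of_nonneg (Real.rpow_nonneg (abs_nonneg _) _)]; exact hZpow_le y
  have hZpow_bd : ∫ y, |Z y| ^ (2 * q) ∂μ ≤ (4 * h * q / Real.exp 1) ^ (2 * q) * (2 * Real.exp 1) := by
    have hconst : 2 * q / (Real.exp 1 * t) = 4 * h * q / Real.exp 1 := by
      rw [htdef]; field_simp; norm_num
    calc ∫ y, |Z y| ^ (2 * q) ∂μ
        ≤ ∫ y, (2 * q / (Real.exp 1 * t)) ^ (2 * q) * (Real.exp (t * Z y) + Real.exp (-(t * Z y))) ∂μ :=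
          integral_mono_of_nonneg (Filter.Eventually.of_forall fun y => Real.rpow_nonneg (abs_nonneg _) _)
            (((hmgf t ht.le hth).1).const_mul _) (Filter.Eventually.of_forall hZpow_le)
      _ = (2 * q / (Real.exp 1 * t)) ^ (2 * q) * ∫ y, (Real.exp (t * Z y) + Real.exp (-(t * Z y))) ∂μ :=
          integral_const_mul _ _
      _ ≤ (2 * q / (Real.exp 1 * t)) ^ (2 * q) * (2 * Real.exp 1) :=
          mul_le_mul_of_nonneg_left (hmgf t ht.le hth).2 (by positivity)
      _ = _ := by rw [hconst]
  -- the exponential factor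
  have h2q : 0 ≤ 2 * q := by positivity
  have h2qh : 2 * q * h ≤ 1 / 2 := by linarith
  have hexp_le : ∀ y, Real.exp (2 * q * |Z y|) ≤ Real.exp (2 * q * Z y) + Real.exp (-(2 * q * Z y)) := by
    intro y
    rcases le_or_gt 0 (Z y) with h0 | h0
    · rw [abs_of_nonneg h0]; linarith [Real.exp_pos (-(2 * q * Z y))]
    · rw [abs_of_neg h0, show 2 * q * -Z y = -(2 * q * Z y) by ring]; linarith [Real.exp_pos (2 * q * Z y)]
  have hexp_int : Integrable (fun y => Real.exp (2 * q * |Z y|)) μ := by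
    refine Integrable.mono' (hmgf (2 * q) h2q h2qh).1 ?_ (Filter.Eventually.of_forall fun y => ?_)
    · exact (Real.continuous_exp.comp (continuous_const.mul continuous_id)).comp_aestronglyMeasurable hZabs_m
    · rw [Real.norm_of_nonneg (Real.exp_pos _).le]; exact hexp_le y
  have hexp_bd : ∫ y, Real.exp (2 * q * |Z y|) ∂μ ≤ 2 * Real.exp 1 :=
    (integral_mono_of_nonneg (Filter.Eventually.of_forall fun y => (Real.exp_pos _).le)
      (hmgf (2 * q) h2q h2qh).1 (Filter.Eventually.of_forall hexp_le)).trans (hmgf (2 * q) h2q h2qh).2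
  -- assemble
  set D : α → ℝ := fun y => (|Z y| ^ (2 * q) + a ^ 2 * Real.exp (2 * q * |Z y|)) / (2 * a) with hDdef
  have hDint : Integrable D μ := (hZpow_int.add (hexp_int.const_mul _)).div_const _
  have hgm : AEStronglyMeasurable (fun y => (|Z y| * Real.exp |Z y|) ^ q) μ := by
    have hc : Continuous fun x : ℝ => (|x| * Real.exp |x|) ^ q :=
      (continuous_abs.mul (Real.continuous_exp.comp continuous_abs)).rpow_const fun _ => Or.inr hq0.le
    exact hc.comp_aestronglyMeasurable hZm
  have hgint : Integrable (fun y => (|Z y| * Real.exp |Z y|) ^ q) μ :=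
    Integrable.mono' hDint hgm (Filter.Eventually.of_forall fun y => by
      rw [Real.norm_of_nonneg (Real.rpow_nonneg (by positivity) _)]; exact hgq y)
  refine ⟨hgint, ?_⟩
  calc ∫ y, (|Z y| * Real.exp |Z y|) ^ q ∂μ ≤ ∫ y, D y ∂μ :=
        integral_mono_of_nonneg (Filter.Eventually.of_forall fun y => Real.rpow_nonneg (by positivity) _)
          hDint (Filter.Eventually.of_forall hgq)
    _ = (∫ y, |Z y| ^ (2 * q) ∂μ + a ^ 2 * ∫ y, Real.exp (2 * q * |Z y|) ∂μ) / (2 * a) := by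
        simp only [hDdef]
        rw [integral_div, integral_add hZpow_int (hexp_int.const_mul _), integral_const_mul]
    _ ≤ ((4 * h * q / Real.exp 1) ^ (2 * q) * (2 * Real.exp 1) + a ^ 2 * (2 * Real.exp 1)) / (2 * a) := by
        gcongr
    _ = a * (2 * Real.exp 1) := by
        rw [← ha2]; field_simp; ring

/-! ## Exponential moments of the log-density `Z = c + ½Q` -/

/-- **Exponential moments of `Z = c + ½(yᵀBy − tr T)`** under `N(0,S)`: for `S ≻ 0`, `B` symmetric,
`T = √S B √S` with `tr(T²) ≤ h²`, `h ≤ ¼`, `|c| ≤ h²` and `|s|·h ≤ ½`, the function `e^{sZ}` is integrable and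
`∫ e^{sZ} dN(0,S) ≤ e` (from `E e^{(s/2)Q} ≤ e^{s²h²}`). [cite: Buchholz2016, Thm 4.5 (proof)] -/
theorem integral_exp_mul_logDensity_le {S : Matrix ι ι ℝ} (hS : S.PosDef) {B : Matrix ι ι ℝ}
    (hB : Bᵀ = B) {h c s : ℝ} (hh0 : 0 ≤ h) (hh4 : h ≤ 1 / 4)
    (htr : ((CFC.sqrt S * B * CFC.sqrt S) * (CFC.sqrt S * B * CFC.sqrt S)).trace ≤ h ^ 2)
    (hc : |c| ≤ h ^ 2) (hs : |s| * h ≤ 1 / 2) :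
    Integrable (fun y : EuclideanSpace ℝ ι =>
        Real.exp (s * (c + (ofLp y ⬝ᵥ B *ᵥ ofLp y - (CFC.sqrt S * B * CFC.sqrt S).trace) / 2)))
        (multivariateGaussian 0 S) ∧
      ∫ y, Real.exp (s * (c + (ofLp y ⬝ᵥ B *ᵥ ofLp y - (CFC.sqrt S * B * CFC.sqrt S).trace) / 2))
        ∂(multivariateGaussian 0 S) ≤ Real.exp 1 := by
  set T : Matrix ι ι ℝ := CFC.sqrt S * B * CFC.sqrt S with hTdef
  have hs' : 2 * |s / 2| * h ≤ 1 / 2 := by rw [abs_div, abs_two]; linarith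
  have hsplit : ∀ y : EuclideanSpace ℝ ι, Real.exp (s * (c + (ofLp y ⬝ᵥ B *ᵥ ofLp y - T.trace) / 2)) =
      Real.exp (s * c) * Real.exp (s / 2 * (ofLp y ⬝ᵥ B *ᵥ ofLp y - T.trace)) := fun y => by
    rw [← Real.exp_add]; congr 1; ring
  have hsplit' : ∀ y : EuclideanSpace ℝ ι, Real.exp (s * (c + (ofLp y ⬝ᵥ B *ᵥ ofLp y - T.trace) / 2)) =
      Real.exp (s * c - s / 2 * T.trace) * Real.exp (s / 2 * (ofLp y ⬝ᵥ B *ᵥ ofLp y)) := fun y => by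
    rw [← Real.exp_add]; congr 1; ring
  refine ⟨?_, ?_⟩
  · have := (integrable_exp_mul_quadForm hB hh0 htr hs').const_mul (Real.exp (s * c - s / 2 * T.trace))
    exact this.congr (Filter.Eventually.of_forall fun y => (hsplit' y).symm)
  · have h1 := integral_exp_mul_quadForm_sub_trace_le hS hB hh0 htr hs'
    simp_rw [hsplit]
    rw [integral_const_mul]
    have hexp : s * c + 4 * (s / 2) ^ 2 * h ^ 2 ≤ 1 := by
      have h2 : (|s| * h) ^ 2 ≤ (1 / 2) ^ 2 := pow_le_pow_left₀ (by positivity) hs 2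
      have h3 : s * c ≤ |s| * h ^ 2 := by
        calc s * c ≤ |s * c| := le_abs_self _
          _ = |s| * |c| := abs_mul _ _
          _ ≤ |s| * h ^ 2 := mul_le_mul_of_nonneg_left hc (abs_nonneg _)
      have h5 : (|s| * h) * h ≤ 1 / 2 * (1 / 4) := mul_le_mul hs hh4 hh0 (by norm_num)
      have h6 : 4 * (s / 2) ^ 2 * h ^ 2 = (|s| * h) ^ 2 := by rw [mul_pow, sq_abs]; ring
      rw [h6]
      nlinarith
    calc Real.exp (s * c) * ∫ y, Real.exp (s / 2 * (ofLp y ⬝ᵥ B *ᵥ ofLp y - T.trace)) ∂(multivariateGaussian 0 S)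
        ≤ Real.exp (s * c) * Real.exp (4 * (s / 2) ^ 2 * h ^ 2) :=
          mul_le_mul_of_nonneg_left h1 (Real.exp_pos _).le
      _ = Real.exp (s * c + 4 * (s / 2) ^ 2 * h ^ 2) := by rw [← Real.exp_add]
      _ ≤ Real.exp 1 := Real.exp_le_exp.2 hexp

/-- Two-sided form: `∫ (e^{tZ} + e^{−tZ}) dN(0,S) ≤ 2e` for `0 ≤ t`, `t·h ≤ ½` (with integrability).
[cite: Buchholz2016, Thm 4.5 (proof)] -/
theorem integral_exp_add_exp_logDensity_le {S : Matrix ι ι ℝ} (hS : S.PosDef) {B : Matrix ι ι ℝ}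
    (hB : Bᵀ = B) {h c t : ℝ} (hh0 : 0 ≤ h) (hh4 : h ≤ 1 / 4)
    (htr : ((CFC.sqrt S * B * CFC.sqrt S) * (CFC.sqrt S * B * CFC.sqrt S)).trace ≤ h ^ 2)
    (hc : |c| ≤ h ^ 2) (ht : 0 ≤ t) (hth : t * h ≤ 1 / 2) :
    Integrable (fun y : EuclideanSpace ℝ ι =>
        Real.exp (t * (c + (ofLp y ⬝ᵥ B *ᵥ ofLp y - (CFC.sqrt S * B * CFC.sqrt S).trace) / 2)) +
        Real.exp (-(t * (c + (ofLp y ⬝ᵥ B *ᵥ ofLp y - (CFC.sqrt S * B * CFC.sqrt S).trace) / 2))))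
        (multivariateGaussian 0 S) ∧
      ∫ y, (Real.exp (t * (c + (ofLp y ⬝ᵥ B *ᵥ ofLp y - (CFC.sqrt S * B * CFC.sqrt S).trace) / 2)) +
        Real.exp (-(t * (c + (ofLp y ⬝ᵥ B *ᵥ ofLp y - (CFC.sqrt S * B * CFC.sqrt S).trace) / 2))))
        ∂(multivariateGaussian 0 S) ≤ 2 * Real.exp 1 := by
  have ha : |t| * h ≤ 1 / 2 := by rwa [abs_of_nonneg ht]
  have hb : |(-t)| * h ≤ 1 / 2 := by rwa [abs_neg, abs_of_nonneg ht]
  obtain ⟨i1, b1⟩ := integral_exp_mul_logDensity_le hS hB hh0 hh4 htr hc ha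
  obtain ⟨i2, b2⟩ := integral_exp_mul_logDensity_le hS hB hh0 hh4 htr hc hb
  have hneg : ∀ y : EuclideanSpace ℝ ι,
      Real.exp (-(t * (c + (ofLp y ⬝ᵥ B *ᵥ ofLp y - (CFC.sqrt S * B * CFC.sqrt S).trace) / 2))) =
      Real.exp ((-t) * (c + (ofLp y ⬝ᵥ B *ᵥ ofLp y - (CFC.sqrt S * B * CFC.sqrt S).trace) / 2)) :=
    fun y => by congr 1; ring
  simp_rw [hneg]
  refine ⟨i1.add i2, ?_⟩
  rw [integral_add i1 i2]
  linarith

/-! ## The normalising constant: `c = ½ Σ (log(1 − λᵢ) + λᵢ) ∈ [−h², 0]` -/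

omit [DecidableEq ι] in
/-- For reals `λᵢ` with `|λᵢ| ≤ h ≤ ¼` and `Σ λᵢ² ≤ h²`:  `−h² ≤ ½Σ(log(1−λᵢ) + λᵢ) ≤ 0`.
[cite: Buchholz2016, Thm 4.5 (proof)] -/
theorem half_sum_log_one_sub_add_mem {lam : ι → ℝ} {h : ℝ} (hh4 : h ≤ 1 / 4) (hlam : ∀ i, |lam i| ≤ h)
    (hsq : ∑ i, lam i ^ 2 ≤ h ^ 2) :
    -h ^ 2 ≤ (∑ i, (Real.log (1 - lam i) + lam i)) / 2 ∧ (∑ i, (Real.log (1 - lam i) + lam i)) / 2 ≤ 0 := by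
  constructor
  · have hsum : ∑ i, (-(2 * lam i ^ 2)) ≤ ∑ i, (Real.log (1 - lam i) + lam i) :=
      Finset.sum_le_sum fun i _ => by
        have h1 := neg_sub_two_sq_le_log_one_sub (show |lam i| ≤ 1 / 2 by linarith [hlam i])
        linarith
    have : ∑ i, (-(2 * lam i ^ 2)) = -(2 * ∑ i, lam i ^ 2) := by
      rw [Finset.mul_sum, ← Finset.sum_neg_distrib]
    rw [this] at hsum
    linarith
  · have : ∑ i, (Real.log (1 - lam i) + lam i) ≤ 0 :=
      Finset.sum_nonpos fun i _ => by
        have h1 := log_one_sub_le_neg (show lam i < 1 by have := (abs_le.1 (hlam i)).2; linarith)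
        linarith
    linarith

/-! ## The comparison estimate -/

/-- **Two non-degenerate centred Gaussians whose covariances are close in HILBERT–SCHMIDT sense have close
expectations of `L^p` functionals, with a DIMENSION-FREE constant** ([Buc16] Thm 4.5 / [ABKM19] Thm 6.2,
`ℓ = 1`, integrated form).  Let `S₀, S₁ ≻ 0`, `B = S₀⁻¹ − S₁⁻¹`, and suppose
`tr((S₀B)²) = tr((1 − S₀S₁⁻¹)²) ≤ h²` with `0 ≤ h ≤ 1/(4q)`, `p, q` Hölder conjugate, `H ∈ L^p(N(0,S₀))`.  Then
`|∫ H dN(0,S₁) − ∫ H dN(0,S₀)| ≤ 8 q h · (∫ |H|^p dN(0,S₀))^{1/p}`.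
The constant does not depend on `|ι|`: the per-mode relative changes of the covariance enter through the
sum of their squares (`h`), not through `|ι| · sup`.  Proof: `dN(0,S₁)/dN(0,S₀) = e^{Z}`, `Z = c + ½Q` with
`Q = yᵀBy − tr(√S₀B√S₀)` the centred chaos (`E e^{sQ} ≤ e^{4s²h²}`) and `−h² ≤ c ≤ 0`;
`|e^Z − 1| ≤ |Z|e^{|Z|}`, `integral_rpow_abs_mul_exp_abs_le`, Hölder. [cite: Buchholz2016, Thm 4.5] -/
theorem abs_integral_multivariateGaussian_sub_le_of_trace {S₀ S₁ : Matrix ι ι ℝ} (hS₀ : S₀.PosDef)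
    (hS₁ : S₁.PosDef) {h : ℝ} (hh0 : 0 ≤ h)
    (htr : ((S₀ * (S₀⁻¹ - S₁⁻¹)) * (S₀ * (S₀⁻¹ - S₁⁻¹))).trace ≤ h ^ 2)
    {p q : ℝ} (hpq : p.HolderConjugate q) (hhq : h ≤ 1 / (4 * q))
    {H : EuclideanSpace ℝ ι → ℝ} (hH : MemLp H (ENNReal.ofReal p) (multivariateGaussian 0 S₀)) :
    |∫ y, H y ∂(multivariateGaussian 0 S₁) - ∫ y, H y ∂(multivariateGaussian 0 S₀)| ≤
      8 * q * h * (∫ y, |H y| ^ p ∂(multivariateGaussian 0 S₀)) ^ (1 / p) := by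
  set μ := multivariateGaussian 0 S₀ with hμ
  have hp1 : 1 < p := hpq.lt
  have hq1 : 1 < q := hpq.symm.lt
  have hq0 : 0 < q := by linarith
  have hqh : q * h ≤ 1 / 4 := by
    rw [le_div_iff₀ (by positivity)] at hhq; linarith
  have hh4 : h ≤ 1 / 4 := by
    have : h ≤ q * h := by nlinarith
    linarith
  -- the matrices `B = P₀ − P₁`, `T = √S₀ B √S₀`
  set B : Matrix ι ι ℝ := S₀⁻¹ - S₁⁻¹ with hBdef
  have hBt : Bᵀ = B := by
    rw [hBdef, Matrix.transpose_sub, Matrix.transpose_nonsing_inv, Matrix.transpose_nonsing_inv,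
      Literature.Probability.Distributions.transpose_eq_of_posDef hS₀,
      Literature.Probability.Distributions.transpose_eq_of_posDef hS₁]
  set T : Matrix ι ι ℝ := CFC.sqrt S₀ * B * CFC.sqrt S₀ with hTdef
  have hT : T.IsHermitian := isHermitian_sqrt_mul_mul_sqrt S₀ hBt
  have htrT : (T * T).trace ≤ h ^ 2 := by rw [hTdef, trace_sqrt_sandwich_mul_self hS₀ B]; exact htr
  have hRHS0 : 0 ≤ 8 * q * h * (∫ y, |H y| ^ p ∂μ) ^ (1 / p) := by
    have : 0 ≤ (∫ y, |H y| ^ p ∂μ) ^ (1 / p) := Real.rpow_nonneg (integral_nonneg fun y => by positivity) _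
    positivity
  have hsqsum : ∑ i, hT.eigenvalues i ^ 2 ≤ h ^ 2 := by
    -- `Σ λᵢ² = tr(T²)` (spectral theorem; = the tree's `AHRiccati.trace_mul_self_eq_sum_eigenvalues_sq`)
    have htr2 : (T * T).trace = ∑ j, hT.eigenvalues j ^ 2 := by
      have hsp := hT.spectral_theorem
      have hTT : T * T = conjStarAlgAut ℝ (Matrix ι ι ℝ) hT.eigenvectorUnitary
          (diagonal (RCLike.ofReal ∘ hT.eigenvalues) * diagonal (RCLike.ofReal ∘ hT.eigenvalues)) := by
        rw [map_mul, ← hsp]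
      rw [hTT, conjStarAlgAut_apply, trace_mul_cycle, coe_star_mul_self, one_mul, diagonal_mul_diagonal,
        trace_diagonal]
      refine Finset.sum_congr rfl fun j _ => ?_
      simp [pow_two]
    rw [← htr2]; exact htrT
  -- the degenerate case `h = 0`: then `T = 0`, `B = 0`, `S₀ = S₁`
  rcases hh0.eq_or_lt with h0 | hpos
  · have hev : hT.eigenvalues = 0 := by
      funext i
      have h2 : ∑ j, hT.eigenvalues j ^ 2 ≤ 0 := by rw [← h0] at hsqsum; simpa using hsqsum
      have h1 : hT.eigenvalues i ^ 2 ≤ ∑ j, hT.eigenvalues j ^ 2 :=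
        Finset.single_le_sum (f := fun j => hT.eigenvalues j ^ 2) (fun j _ => sq_nonneg _) (Finset.mem_univ i)
      have : hT.eigenvalues i ^ 2 = 0 := le_antisymm (h1.trans h2) (sq_nonneg _)
      simpa using this
    have hT0 : T = 0 := hT.eigenvalues_eq_zero_iff.1 hev
    have hRu : IsUnit (CFC.sqrt S₀).det := (Matrix.isUnit_iff_isUnit_det _).1 (isUnit_sqrt hS₀)
    have hB0 : B = 0 := by
      have : (CFC.sqrt S₀)⁻¹ * T * (CFC.sqrt S₀)⁻¹ = B := by
        rw [hTdef, ← Matrix.mul_assoc, ← Matrix.mul_assoc, Matrix.nonsing_inv_mul _ hRu, Matrix.one_mul,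
          Matrix.mul_nonsing_inv_cancel_right _ _ hRu]
      rw [← this, hT0, Matrix.mul_zero, Matrix.zero_mul]
    have hS : S₁ = S₀ := by
      have hinv : S₀⁻¹ = S₁⁻¹ := sub_eq_zero.1 (by rw [← hBdef]; exact hB0)
      have h0u : IsUnit S₀.det := hS₀.isUnit.map Matrix.detMonoidHom
      have h1u : IsUnit S₁.det := hS₁.isUnit.map Matrix.detMonoidHom
      rw [← Matrix.nonsing_inv_nonsing_inv S₁ h1u, ← hinv, Matrix.nonsing_inv_nonsing_inv S₀ h0u]
    rw [hS, sub_self, abs_zero]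
    exact hRHS0
  -- the main case `h > 0`
  have hμT : ∀ i, |hT.eigenvalues i| ≤ h := abs_eigenvalues_le_of_trace hT hh0 htrT
  set u : EuclideanSpace ℝ ι → ℝ := fun y => ofLp y ⬝ᵥ B *ᵥ ofLp y with hu
  set κ : ℝ := (gaussZ S₀⁻¹ * (gaussZ S₁⁻¹)⁻¹).toReal with hκ
  have hr : ∀ y, (gaussRatio S₀ S₁ y).toReal = κ * Real.exp (u y / 2) := fun y => toReal_gaussRatio y
  have hint_r : ∫ y, κ * Real.exp (u y / 2) ∂μ = 1 := by
    have := integral_gaussRatio hS₀ hS₁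
    simp_rw [hr] at this
    exact this
  -- `∫ e^{u/2} dμ = 1/√det(1 − T)` (regulator formula with `M = B`)
  have hsub1 : ((1 : Matrix ι ι ℝ) - CFC.sqrt S₀ * B * CFC.sqrt S₀).PosDef := by
    have h12 : 2 * |(1 / 2 : ℝ)| * h ≤ 1 / 2 := by
      rw [abs_of_nonneg (by norm_num : (0:ℝ) ≤ 1 / 2)]; linarith
    have := posDef_one_sub_smul_of_trace hT hh0 htrT h12
    rw [show (2 * (1 / 2 : ℝ)) = 1 by norm_num, one_smul] at this
    exact this
  have hI : ∫ y, Real.exp (u y / 2) ∂μ = 1 / Real.sqrt ((1 : Matrix ι ι ℝ) - T).det := by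
    have hmain := Literature.Probability.Distributions.integral_exp_half_quadratic_multivariateGaussian
      (S := S₀) hS₀.posSemidef hBt hsub1
    rw [← Literature.Probability.Distributions.det_one_sub_sqrt_mul_sqrt (sqrt_mul_sqrt hS₀) B] at hmain
    exact hmain
  -- `det(1 − T) = ∏ (1 − λᵢ) > 0` and `log det(1 − T) = Σ log(1 − λᵢ)`
  have hdetprod : ((1 : Matrix ι ι ℝ) - T).det = ∏ i, (1 - hT.eigenvalues i) :=
    Literature.Analysis.Matrix.det_one_sub_eq_prod_one_sub_eigenvalues hT
  have hfac : ∀ i, 0 < 1 - hT.eigenvalues i := fun i => by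
    have := (abs_le.1 (hμT i)).2; linarith
  have hdetpos : 0 < ((1 : Matrix ι ι ℝ) - T).det := by
    rw [hdetprod]; exact Finset.prod_pos fun i _ => hfac i
  have hspos : 0 < Real.sqrt ((1 : Matrix ι ι ℝ) - T).det := Real.sqrt_pos.2 hdetpos
  have hκeq : κ = Real.sqrt ((1 : Matrix ι ι ℝ) - T).det := by
    have hκI : κ * ∫ y, Real.exp (u y / 2) ∂μ = 1 := by rw [← integral_const_mul]; exact hint_r
    rw [hI, mul_one_div, div_eq_one_iff_eq hspos.ne'] at hκI
    exact hκI
  have hκpos : 0 < κ := by rw [hκeq]; exact hspos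
  -- `c = log κ + ½ tr T ∈ [−h², 0]`
  set c : ℝ := Real.log κ + T.trace / 2 with hcdef
  have htrT' : T.trace = ∑ i, hT.eigenvalues i := by
    have := hT.trace_eq_sum_eigenvalues; simpa using this
  have hlogκ : Real.log κ = (∑ i, Real.log (1 - hT.eigenvalues i)) / 2 := by
    rw [hκeq, Real.log_sqrt hdetpos.le, hdetprod, Real.log_prod (fun i _ => (hfac i).ne')]
  have hc_eq : c = (∑ i, (Real.log (1 - hT.eigenvalues i) + hT.eigenvalues i)) / 2 := by
    rw [hcdef, hlogκ, htrT', Finset.sum_add_distrib]; ring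
  have hc_abs : |c| ≤ h ^ 2 := by
    obtain ⟨h1, h2⟩ := half_sum_log_one_sub_add_mem hh4 hμT hsqsum
    rw [hc_eq]
    exact abs_le.2 ⟨h1, h2.trans (by positivity)⟩
  -- `Z = log κ + u/2 = c + Q/2`, `Q = u − tr T`
  set Z : EuclideanSpace ℝ ι → ℝ := fun y => c + (u y - T.trace) / 2 with hZdef
  have hreq : ∀ y, (gaussRatio S₀ S₁ y).toReal = Real.exp (Z y) := fun y => by
    rw [hr y, ← Real.exp_log hκpos, ← Real.exp_add]
    congr 1
    simp only [hZdef, hcdef]; ring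
  have hcont_u : Continuous u := by
    have hc : Continuous fun x : EuclideanSpace ℝ ι => (ofLp x : ι → ℝ) := PiLp.continuous_ofLp 2 _
    exact hc.dotProduct (continuous_const.matrix_mulVec hc)
  have hcont_Z : Continuous Z := continuous_const.add ((hcont_u.sub continuous_const).div_const _)
  -- two-sided exponential moments of `Z` and the `q`-th moment of `g = |Z| e^{|Z|}`
  have hmgf : ∀ t : ℝ, 0 ≤ t → t * h ≤ 1 / 2 →
      Integrable (fun y => Real.exp (t * Z y) + Real.exp (-(t * Z y))) μ ∧
      ∫ y, (Real.exp (t * Z y) + Real.exp (-(t * Z y))) ∂μ ≤ 2 * Real.exp 1 :=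
    fun t ht hth => integral_exp_add_exp_logDensity_le hS₀ hBt hh0 hh4 htrT hc_abs ht hth
  obtain ⟨hgint, hgbd⟩ := integral_rpow_abs_mul_exp_abs_le (μ := μ) hcont_Z.aestronglyMeasurable hpos hq1 hqh hmgf
  -- `ρ = r − 1`, `|ρ| ≤ g`
  set g : EuclideanSpace ℝ ι → ℝ := fun y => |Z y| * Real.exp |Z y| with hg
  have hg0 : ∀ y, 0 ≤ g y := fun y => by positivity
  have hgcont : Continuous g := (continuous_abs.comp hcont_Z).mul (Real.continuous_exp.comp
    (continuous_abs.comp hcont_Z))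
  have hrg : ∀ y, |(gaussRatio S₀ S₁ y).toReal - 1| ≤ g y := fun y => by
    rw [hreq y]; exact Literature.NumberTheory.Sieve.BombieriSieve.abs_exp_sub_one_le _
  have hqE : ENNReal.ofReal q ≠ 0 := by simp [hq0]
  have hgint' : Integrable (fun y => ‖g y‖ ^ q) μ :=
    hgint.congr (Filter.Eventually.of_forall fun y => by
      simp only [hg]; rw [Real.norm_of_nonneg (hg0 y)])
  have hgLq : MemLp g (ENNReal.ofReal q) μ := by
    rw [← integrable_norm_rpow_iff hgcont.aestronglyMeasurable hqE ENNReal.ofReal_ne_top,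
      ENNReal.toReal_ofReal hq0.le]
    exact hgint'
  set ρ : EuclideanSpace ℝ ι → ℝ := fun y => (gaussRatio S₀ S₁ y).toReal - 1 with hρ
  have hρmeas : AEStronglyMeasurable ρ μ := by
    have : Continuous fun y => (gaussRatio S₀ S₁ y).toReal :=
      (Real.continuous_exp.comp hcont_Z).congr fun y => (hreq y).symm
    exact (this.sub continuous_const).aestronglyMeasurable
  have hρLq : MemLp ρ (ENNReal.ofReal q) μ :=
    hgLq.of_le hρmeas (Filter.Eventually.of_forall fun y => by
      rw [Real.norm_eq_abs, Real.norm_of_nonneg (hg0 y)]; exact hrg y)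
  -- Hölder with `H`
  haveI : ENNReal.HolderConjugate (ENNReal.ofReal p) (ENNReal.ofReal q) :=
    ENNReal.holderConjugate_iff.2 hpq.inv_add_inv_ennreal
  have hρH : Integrable (fun y => ρ y * H y) μ := by
    have h := MemLp.mul' (f := H) (φ := ρ) (r := 1) hH hρLq
    exact memLp_one_iff_integrable.1 h
  have hHint : Integrable H μ := hH.integrable (by
    rw [← ENNReal.ofReal_one]; exact ENNReal.ofReal_le_ofReal hp1.le)
  have hdiff : ∫ y, H y ∂(multivariateGaussian 0 S₁) - ∫ y, H y ∂μ = ∫ y, ρ y * H y ∂μ := by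
    rw [integral_multivariateGaussian_eq_integral_gaussRatio_mul hS₀ hS₁, ← integral_sub _ hHint]
    · refine integral_congr_ae (Filter.Eventually.of_forall fun y => ?_)
      simp only [hρ]; ring
    · have : (fun y => (gaussRatio S₀ S₁ y).toReal * H y) = fun y => ρ y * H y + H y := by
        funext y; simp only [hρ]; ring
      rw [this]
      exact hρH.add hHint
  rw [hdiff]
  have hholder := integral_mul_norm_le_Lp_mul_Lq hpq hH hρLq
  have habs : |∫ y, ρ y * H y ∂μ| ≤ ∫ y, ‖H y‖ * ‖ρ y‖ ∂μ := by
    rw [← Real.norm_eq_abs]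
    refine (norm_integral_le_integral_norm _).trans (le_of_eq ?_)
    refine integral_congr_ae (Filter.Eventually.of_forall fun y => ?_)
    simp only [norm_mul]; ring
  refine habs.trans (hholder.trans ?_)
  -- `(∫ |ρ|^q)^{1/q} ≤ ((4hq/e)^q · 2e)^{1/q} ≤ 8 q h`
  have hbase : 0 < 4 * h * q / Real.exp 1 := by positivity
  have hρq_le : ∫ y, ‖ρ y‖ ^ q ∂μ ≤ (4 * h * q / Real.exp 1) ^ q * (2 * Real.exp 1) := by
    calc ∫ y, ‖ρ y‖ ^ q ∂μ ≤ ∫ y, ‖g y‖ ^ q ∂μ := by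
          refine integral_mono_of_nonneg (Filter.Eventually.of_forall fun y => by positivity) hgint'
            (Filter.Eventually.of_forall fun y => ?_)
          exact Real.rpow_le_rpow (norm_nonneg _)
            (by rw [Real.norm_eq_abs, Real.norm_of_nonneg (hg0 y)]; exact hrg y) hq0.le
      _ = ∫ y, (|Z y| * Real.exp |Z y|) ^ q ∂μ :=
          integral_congr_ae (Filter.Eventually.of_forall fun y => by
            simp only [hg]; rw [Real.norm_of_nonneg (hg0 y)])
      _ ≤ _ := hgbd
  have he1 : 1 ≤ 2 * Real.exp 1 := by
    have := Real.add_one_le_exp (1 : ℝ); linarith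
  have hroot : (∫ y, ‖ρ y‖ ^ q ∂μ) ^ (1 / q) ≤ 8 * q * h := by
    calc (∫ y, ‖ρ y‖ ^ q ∂μ) ^ (1 / q) ≤ ((4 * h * q / Real.exp 1) ^ q * (2 * Real.exp 1)) ^ (1 / q) :=
          Real.rpow_le_rpow (integral_nonneg fun y => by positivity) hρq_le (by positivity)
      _ = (4 * h * q / Real.exp 1) * (2 * Real.exp 1) ^ (1 / q) := by
          rw [Real.mul_rpow (Real.rpow_nonneg hbase.le _) (by positivity), ← Real.rpow_mul hbase.le,
            mul_one_div_cancel hq0.ne', Real.rpow_one]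
      _ ≤ (4 * h * q / Real.exp 1) * (2 * Real.exp 1) := by
          refine mul_le_mul_of_nonneg_left ?_ hbase.le
          calc (2 * Real.exp 1) ^ (1 / q) ≤ (2 * Real.exp 1) ^ (1 : ℝ) :=
                Real.rpow_le_rpow_of_exponent_le he1 (by rw [div_le_one hq0]; exact hq1.le)
            _ = 2 * Real.exp 1 := Real.rpow_one _
      _ = 8 * q * h := by field_simp; ring
  have hHp0 : 0 ≤ (∫ y, ‖H y‖ ^ p ∂μ) ^ (1 / p) := Real.rpow_nonneg (integral_nonneg fun y => by positivity) _
  have hnormH : (∫ y, ‖H y‖ ^ p ∂μ) = ∫ y, |H y| ^ p ∂μ := by simp only [Real.norm_eq_abs]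
  calc (∫ y, ‖H y‖ ^ p ∂μ) ^ (1 / p) * (∫ y, ‖ρ y‖ ^ q ∂μ) ^ (1 / q)
      ≤ (∫ y, ‖H y‖ ^ p ∂μ) ^ (1 / p) * (8 * q * h) := mul_le_mul_of_nonneg_left hroot hHp0
    _ = 8 * q * h * (∫ y, |H y| ^ p ∂μ) ^ (1 / p) := by rw [hnormH]; ring

end Literature.MathematicalPhysics.QuantumFieldTheory

end
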